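import Mathlib
import Summits.NavierStokesRegularity.NavierStokesRegularity.Theorems.ThreadingFluxHorizonTowerCubicCertZonal
import Summits.NavierStokesRegularity.NavierStokesRegularity.Theorems.ThreadingFluxHorizonTowerHomogeneousCubic
import Summits.NavierStokesRegularity.NavierStokesRegularity.Theorems.ThreadingFluxHorizonTowerCubicCertCoeffs
import HarnessLib

/-!
# Crux `PoloidalLiouville` (stmt-NavierStokesRegularity-1222, wall W1), crux idea «horizon-threading-tower» (ns-idea-15):
# a smooth degree-3 homogeneous HARMONIC `H : ℝ³ → ℝ` is `cubicHE3 a` for some `a` — the abstract-to-explicit bridge, part b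

Support file (Theorems-side tooling, `--supports stmt-NavierStokesRegularity-1222 --as helper`; seat ns-wall-eng-7 g3, cell ns-wall-extremal,
item HT1-CERT-CORE).  With part a (`exists_cubicCoeff_of_homogeneous`) a smooth degree-3 homogeneous `H` is a cubic form `Σ Tᵢⱼₖ yᵢyⱼyₖ`;
here the Laplacian of such a form is computed from LINE restrictions (`Δ = Σₘ ∂ₘ²`, second derivative of an explicit cubic in the line
parameter) and `ΔH = 0` is converted into the three linear relations that place the form in the span of the basis `B₁..B₇` of record:

* `HorizonTower.iteratedFDeriv_two_eq_iteratedDeriv_line` — `D²F(x)(v,v) = (d/dt)²|₀ F(x + t v)` for `C²` maps;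
* `HorizonTower.laplacian_eq_sum_iteratedDeriv_line` — `ΔF(x) = Σₘ (d/dt)²|₀ F(x + t eₘ)`;
* `HorizonTower.exists_cubicHE3_of_harmonic_homogeneous` — ★ `ContDiff ℝ 3 H → (∀ c y, H (c • y) = c ^ 3 * H y) → (∀ y, ΔH y = 0) →
  ∃ a, ∀ y, H y = CubicCert.cubicHE3 a y`.

CONSEQUENCE (`HorizonTower.horizonZonality_degree_three_of_identification`): the l = 3 instance of `HorizonZonalitySingleDegree` BY NAME now
follows from the single IDENTIFICATION identity `∀ a x, x ≠ 0 → horizonL2 (horizonProfile 3 (cubicHE3 a) 0) 0 x = 0 → horizonNumerator a … = 0`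
(stated here as an explicit hypothesis, NOT proved: it is ENGINE-certified only, DATUM B-ht1).  Information-grade for W1/W2; `PoloidalLiouville`
(1222) / NS regularity OPEN and untouched. [folklore]
-/

-- the summit and its single problem share the name (D-0017 nested layout)
set_option linter.dupNamespace false

noncomputable section

open scoped RealInnerProductSpace

namespace Summit.NavierStokesRegularity.NavierStokesRegularity.Theorems.PoloidalLiouville.HorizonTower

/-- Second derivative along a line: `D²F(x)(v, v) = (d/dt)²|_{t=0} F(x + t v)` for `F` of class `C²`. [folklore] -/
theorem iteratedFDeriv_two_eq_iteratedDeriv_line {F : E3 → ℝ} (hF : ContDiff ℝ 2 F) (x v : E3) :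
    iteratedFDeriv ℝ 2 F x ![v, v] = iteratedDeriv 2 (fun t : ℝ => F (x + t • v)) 0 := by
  have hG : ContDiff ℝ 2 (fun z : E3 => F (x + z)) := hF.comp (contDiff_const.add contDiff_id)
  have hcomp : (fun t : ℝ => F (x + t • v)) = (fun z : E3 => F (x + z)) ∘ (ContinuousLinearMap.toSpanSingleton ℝ v) := by
    funext t
    simp [ContinuousLinearMap.toSpanSingleton_apply]
  rw [iteratedDeriv_eq_iteratedFDeriv, hcomp,
    (ContinuousLinearMap.toSpanSingleton ℝ v).iteratedFDeriv_comp_right hG 0 (by exact_mod_cast le_rfl),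
    ContinuousMultilinearMap.compContinuousLinearMap_apply, iteratedFDeriv_comp_add_left]
  have hv : (![v, v] : Fin 2 → E3) = fun _ => (ContinuousLinearMap.toSpanSingleton ℝ v) (1 : ℝ) := by
    funext i
    fin_cases i <;> simp [ContinuousLinearMap.toSpanSingleton_apply]
  rw [hv]
  simp

/-- The Laplacian on `ℝ³` from line restrictions: `ΔF(x) = Σₘ (d/dt)²|₀ F(x + t eₘ)` for `F` of class `C²`. [folklore] -/
theorem laplacian_eq_sum_iteratedDeriv_line {F : E3 → ℝ} (hF : ContDiff ℝ 2 F) (x : E3) :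
    Laplacian.laplacian F x = ∑ m : Fin 3, iteratedDeriv 2 (fun t : ℝ => F (x + t • EuclideanSpace.single m (1 : ℝ))) 0 := by
  rw [InnerProductSpace.laplacian_eq_iteratedFDeriv_orthonormalBasis F (EuclideanSpace.basisFun (Fin 3) ℝ)]
  refine Finset.sum_congr rfl fun m _ => ?_
  rw [EuclideanSpace.basisFun_apply, iteratedFDeriv_two_eq_iteratedDeriv_line hF]

/-- `(d/dt)²|₀ (A + tB + t²C + t³D) = 2C`. [folklore] -/
theorem iteratedDeriv_two_cubic (A B C D : ℝ) :
    iteratedDeriv 2 (fun t : ℝ => A + t * B + t ^ 2 * C + t ^ 3 * D) 0 = 2 * C := by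
  have hfun : (fun t : ℝ => A + t * B + t ^ 2 * C + t ^ 3 * D) = fun t : ℝ => A + t * B + t * t * C + t * t * t * D := by
    funext t
    ring
  have hd : ∀ t : ℝ, HasDerivAt (fun t : ℝ => A + t * B + t * t * C + t * t * t * D) (B + 2 * t * C + 3 * t ^ 2 * D) t := by
    intro t
    have h := (((hasDerivAt_const t A).add ((hasDerivAt_id' t).mul_const B)).add
      (((hasDerivAt_id' t).mul (hasDerivAt_id' t)).mul_const C)).add
      ((((hasDerivAt_id' t).mul (hasDerivAt_id' t)).mul (hasDerivAt_id' t)).mul_const D)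
    exact h.congr_deriv (by simp only [Pi.mul_apply]; ring)
  have h1 : deriv (fun t : ℝ => A + t * B + t * t * C + t * t * t * D) = fun t => B + 2 * t * C + 3 * t ^ 2 * D :=
    funext fun t => (hd t).deriv
  have hd2 : HasDerivAt (fun t : ℝ => B + 2 * t * C + 3 * t ^ 2 * D) (2 * C) 0 := by
    have hfun2 : (fun t : ℝ => B + 2 * t * C + 3 * t ^ 2 * D) = fun t : ℝ => B + t * (2 * C) + t * t * (3 * D) := by
      funext t
      ring
    rw [hfun2]
    have h := ((hasDerivAt_const (0 : ℝ) B).add ((hasDerivAt_id' (0 : ℝ)).mul_const (2 * C))).add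
      (((hasDerivAt_id' (0 : ℝ)).mul (hasDerivAt_id' (0 : ℝ))).mul_const (3 * D))
    exact h.congr_deriv (by ring)
  rw [hfun, iteratedDeriv_succ, iteratedDeriv_one, h1, hd2.deriv]

/-- The cubic form with coefficient tensor `T`, restricted to the line `x + t v`, is the explicit cubic polynomial in `t` with quadratic
coefficient `Σ Tᵢⱼₖ (xᵢvⱼvₖ + vᵢxⱼvₖ + vᵢvⱼxₖ)`. [folklore] -/
theorem cubicForm_line (T : Fin 3 → Fin 3 → Fin 3 → ℝ) (x v : E3) (t : ℝ) :
    (∑ i : Fin 3, ∑ j : Fin 3, ∑ k : Fin 3, T i j k * ((x + t • v) i * (x + t • v) j * (x + t • v) k))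
      = (∑ i : Fin 3, ∑ j : Fin 3, ∑ k : Fin 3, T i j k * (x i * x j * x k))
        + t * (∑ i : Fin 3, ∑ j : Fin 3, ∑ k : Fin 3, T i j k * (v i * x j * x k + x i * v j * x k + x i * x j * v k))
        + t ^ 2 * (∑ i : Fin 3, ∑ j : Fin 3, ∑ k : Fin 3, T i j k * (x i * v j * v k + v i * x j * v k + v i * v j * x k))
        + t ^ 3 * (∑ i : Fin 3, ∑ j : Fin 3, ∑ k : Fin 3, T i j k * (v i * v j * v k)) := by
  simp only [PiLp.add_apply, PiLp.smul_apply, smul_eq_mul, Finset.mul_sum, ← Finset.sum_add_distrib]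
  refine Finset.sum_congr rfl fun i _ => Finset.sum_congr rfl fun j _ => Finset.sum_congr rfl fun k _ => ?_
  ring

/-- ★ **A smooth degree-3 homogeneous harmonic function on `ℝ³` is an explicit harmonic cubic `cubicHE3 a`.** [folklore] -/
theorem exists_cubicHE3_of_harmonic_homogeneous {H : E3 → ℝ} (hH : ContDiff ℝ 3 H)
    (hhom : ∀ (c : ℝ) (y : E3), H (c • y) = c ^ 3 * H y) (hΔ : ∀ y : E3, Laplacian.laplacian H y = 0) :
    ∃ a : Fin 7 → ℝ, ∀ y : E3, H y = CubicCert.cubicHE3 a y := by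
  obtain ⟨T, hT⟩ := exists_cubicCoeff_of_homogeneous hH hhom
  -- H is the cubic form of T, as a function
  have hHT : H = fun y : E3 => ∑ i : Fin 3, ∑ j : Fin 3, ∑ k : Fin 3, T i j k * (y i * y j * y k) := funext hT
  have hc : ∀ i : Fin 3, ContDiff ℝ 2 fun p : E3 => p i := fun i => (contDiff_euclidean.mp contDiff_id) i
  have hF2 : ContDiff ℝ 2 H := hH.of_le (by norm_num)
  -- the Laplacian of the cubic form at x
  have hlap : ∀ x : E3, Laplacian.laplacian H x
      = ∑ m : Fin 3, 2 * (∑ i : Fin 3, ∑ j : Fin 3, ∑ k : Fin 3, T i j k *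
          (x i * (EuclideanSpace.single m (1 : ℝ) : E3) j * (EuclideanSpace.single m (1 : ℝ) : E3) k
            + (EuclideanSpace.single m (1 : ℝ) : E3) i * x j * (EuclideanSpace.single m (1 : ℝ) : E3) k
            + (EuclideanSpace.single m (1 : ℝ) : E3) i * (EuclideanSpace.single m (1 : ℝ) : E3) j * x k)) := by
    intro x
    rw [laplacian_eq_sum_iteratedDeriv_line hF2]
    refine Finset.sum_congr rfl fun m _ => ?_
    have hfun : (fun t : ℝ => H (x + t • EuclideanSpace.single m (1 : ℝ))) = fun t : ℝ =>
        (∑ i : Fin 3, ∑ j : Fin 3, ∑ k : Fin 3, T i j k * (x i * x j * x k))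
        + t * (∑ i : Fin 3, ∑ j : Fin 3, ∑ k : Fin 3, T i j k * ((EuclideanSpace.single m (1 : ℝ) : E3) i * x j * x k
            + x i * (EuclideanSpace.single m (1 : ℝ) : E3) j * x k + x i * x j * (EuclideanSpace.single m (1 : ℝ) : E3) k))
        + t ^ 2 * (∑ i : Fin 3, ∑ j : Fin 3, ∑ k : Fin 3, T i j k * (x i * (EuclideanSpace.single m (1 : ℝ) : E3) j
            * (EuclideanSpace.single m (1 : ℝ) : E3) k + (EuclideanSpace.single m (1 : ℝ) : E3) i * x j
            * (EuclideanSpace.single m (1 : ℝ) : E3) k + (EuclideanSpace.single m (1 : ℝ) : E3) i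
            * (EuclideanSpace.single m (1 : ℝ) : E3) j * x k))
        + t ^ 3 * (∑ i : Fin 3, ∑ j : Fin 3, ∑ k : Fin 3, T i j k * ((EuclideanSpace.single m (1 : ℝ) : E3) i
            * (EuclideanSpace.single m (1 : ℝ) : E3) j * (EuclideanSpace.single m (1 : ℝ) : E3) k)) := by
      funext t
      rw [hHT]
      exact cubicForm_line T x _ t
    rw [hfun, iteratedDeriv_two_cubic]
  -- the three harmonic relations, read off at the basis vectors
  have hrel : ∀ x : E3, (∑ m : Fin 3, 2 * (∑ i : Fin 3, ∑ j : Fin 3, ∑ k : Fin 3, T i j k *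
          (x i * (EuclideanSpace.single m (1 : ℝ) : E3) j * (EuclideanSpace.single m (1 : ℝ) : E3) k
            + (EuclideanSpace.single m (1 : ℝ) : E3) i * x j * (EuclideanSpace.single m (1 : ℝ) : E3) k
            + (EuclideanSpace.single m (1 : ℝ) : E3) i * (EuclideanSpace.single m (1 : ℝ) : E3) j * x k))) = 0 :=
    fun x => by rw [← hlap x]; exact hΔ x
  have hR0 : 3 * T 0 0 0 + (T 0 1 1 + T 1 0 1 + T 1 1 0) + (T 0 2 2 + T 2 0 2 + T 2 2 0) = 0 := by
    have h := hrel (EuclideanSpace.single 0 (1 : ℝ))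
    simp +decide only [Fin.sum_univ_three, Fin.isValue, PiLp.single_apply, ↓reduceIte] at h
    linarith
  have hR1 : 3 * T 1 1 1 + (T 1 0 0 + T 0 1 0 + T 0 0 1) + (T 1 2 2 + T 2 1 2 + T 2 2 1) = 0 := by
    have h := hrel (EuclideanSpace.single 1 (1 : ℝ))
    simp +decide only [Fin.sum_univ_three, Fin.isValue, PiLp.single_apply, ↓reduceIte] at h
    linarith
  have hR2 : 3 * T 2 2 2 + (T 2 0 0 + T 0 2 0 + T 0 0 2) + (T 2 1 1 + T 1 2 1 + T 1 1 2) = 0 := by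
    have h := hrel (EuclideanSpace.single 2 (1 : ℝ))
    simp +decide only [Fin.sum_univ_three, Fin.isValue, PiLp.single_apply, ↓reduceIte] at h
    linarith
  -- the coefficients in the basis of record
  refine ⟨![(T 2 2 2) / 2,
    (T 0 2 2 + T 2 0 2 + T 2 2 0) / 4,
    (T 1 2 2 + T 2 1 2 + T 2 2 1) / 4,
    (T 0 0 2 + T 0 2 0 + T 2 0 0) + 3 * (T 2 2 2) / 2,
    (T 0 1 2 + T 0 2 1 + T 1 0 2 + T 1 2 0 + T 2 0 1 + T 2 1 0),
    T 0 0 0 + (T 0 2 2 + T 2 0 2 + T 2 2 0) / 4,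
    ((T 0 0 1 + T 0 1 0 + T 1 0 0) + (T 1 2 2 + T 2 1 2 + T 2 2 1) / 4) / 3], fun y => ?_⟩
  rw [hT y]
  simp only [CubicCert.cubicHE3, CubicCert.cubicH, Fin.sum_univ_three, Fin.isValue, Matrix.cons_val_zero, Matrix.cons_val_one,
    Matrix.cons_val_two, Matrix.head_cons, Matrix.tail_cons, Matrix.cons_val]
  linear_combination (y 0 * y 1 ^ 2) * hR0 + (y 1 ^ 3 / 3) * hR1 + (y 1 ^ 2 * y 2) * hR2

/-- ★ **`HorizonZonalitySingleDegree` at `l = 3`, MODULO THE IDENTIFICATION STEP.**  The hypothesis `hident` is the engines' identification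
in its weakest useful form — «where `𝔏₂[U_{H_a}]` vanishes, the recorded numerator vanishes» — ENGINE-CERTIFIED ONLY (DATUM B-ht1, two exact
engines); it is NOT proved anywhere in the tree, so this theorem is CONDITIONAL on it and closes nothing.  Given it, every smooth degree-3
homogeneous harmonic `H` whose horizon profile is annihilated by `𝔏₂` off the origin has the zonal functional form — literally the body of
`HorizonTower.HorizonZonalitySingleDegree` with `l := 3` (slice-free kernel certificate `CubicCert.*` + the bridges of this file family). -/
theorem horizonZonality_degree_three_of_identification
    (hident : ∀ (a : Fin 7 → ℝ) (x : E3), x ≠ 0 → horizonL2 (horizonProfile 3 (CubicCert.cubicHE3 a) 0) 0 x = 0 →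
      CubicCert.horizonNumerator a (x 0) (x 1) (x 2) = 0)
    (H : E3 → ℝ) (hH : ContDiff ℝ (⊤ : ℕ∞) H) (hhom : ∀ (c : ℝ) (y : E3), H (c • y) = c ^ 3 * H y)
    (hΔ : ∀ y : E3, Laplacian.laplacian H y = 0) (hL2 : ∀ x : E3, x ≠ 0 → horizonL2 (horizonProfile 3 H 0) 0 x = 0) :
    ∃ (a : E3) (g : ℝ → ℝ), a ≠ 0 ∧ ∀ y : E3, y ≠ 0 → H y = ‖y‖ ^ 3 * g (inner ℝ a y / ‖y‖) := by
  have hH3 : ContDiff ℝ 3 H := (contDiff_infty.mp hH) 3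
  obtain ⟨a, ha⟩ := exists_cubicHE3_of_harmonic_homogeneous hH3 hhom hΔ
  have hHa : H = CubicCert.cubicHE3 a := funext ha
  subst hHa
  exact CubicCert.zonalForm_of_horizonNumerator_eq_zero a fun x hx => hident a x hx (hL2 x hx)

end Summit.NavierStokesRegularity.NavierStokesRegularity.Theorems.PoloidalLiouville.HorizonTower

end
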